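import Summits.BirchSwinnertonDyer.Rank1Residual.X4.HeckeDerivativeFamily
import HarnessLib

/-!
# SHIFTED Hecke-derivative families `U ↦ D^a_U γ = (∏_{q ∈ U} (H_q − a_q)) γ` with prime-dependent shifts `a_q` (cell `b2b-bsdres`, seat additive-p4 gen 32, line V54 — the currency of the ADDITIVE certificate at modulus `p^e`, where `a_q(E) ≢ 2`)

HONEST FRAMING (verbatim, cell `b2b-bsdres`): the goal of the cell is to DELETE the COMBINATION-SHAPED
residual classes for ALL analytic-rank `≤ 1` curves over `ℚ` — "full BSD formula for every rank `≤ 1`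
curve in class `C`" assembled STRICTLY from published theorems — so that the rank-`≤ 1` remainder
becomes exactly the CONSTRUCTION-SHAPED classes, which are TYPED (missing-input Props), NOT attempted;
this is not "finishing BSD". This file: TOOL theorems (pure algebra of periodic functions `ℚ → R`),
2 plain `def`s (the shifted derivative `heckeShift` and the family `shiftDeriv`), 0 facts, nothing
booked; X4 CONSTRUCTION-SHAPED; no mark moves.

## Why

Gen 30's `derivFamily γ U = d_U γ` (`X4/HeckeDerivativeFamily.lean`) iterates `d_q = H_q − 2`, the
derivative at a Kolyvagin prime read modulo `p^k` (`a_q ≡ 2`). The ADDITIVE certificate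
`PlusSymbolLevelLowersAdditivelyModAt W p f m ℓ₁ ℓ₂` (gen 31, `X4/KuriharaAdditiveCertificate.lean`) is
stated at a modulus `m = p^e` with the TRUE traces: its families satisfy
`H_q (D U) = a_q(E)·D U + D(U ∪ {q})`, i.e. `D U = (∏_{q∈U} (H_q − a_q(E))) D ∅`. This file supplies
that family for an arbitrary shift function `a : ℕ → R`:

* `heckeShift a q μ = H_q μ − a q · μ`; periodicity, linearity, `heckeShift_comm` (from
  `heckeTransform_comm`), `heckeShift_comp_natMul` (`E_q (μ∘[c]) = (E_q μ)∘[c]`, `c` prime to `q`).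
* `shiftDeriv a γ U` — `D^a_U γ`, realised along the sorted list of `U`; order independence
  (`shiftDerivList_perm`), `shiftDeriv_insert`, **`heckeTransform_shiftDeriv`**
  (`H_q (D_U γ) = a_q·D_U γ + D_{U∪q} γ`, `q ∉ U` prime), **`shiftDeriv_heckeShift`**
  (`D_U (E_q γ) = D_{U∪q} γ` — the inner shift commutes out), linearity (`_add`, `_const_mul`,
  `_sub`, `_zero`) and `shiftDeriv_comp_natMul` (`D_U (γ∘[c]) = (D_U γ)∘[c]`, `c` prime to `U`).

Consumers (this line): `X4/KuriharaAdditiveCertificateOfCocycle.lean` (the certificate from level-1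
data + the cocycle condition) and `X4/KuriharaAdditiveCertificateOfExactness.lean`.

## References

* B. Mazur, J. Tate, J. Teitelbaum, Invent. Math. 84 (1986), §I.4 (4.2). [cite: MazurTateTeitelbaum1986Invent, §I.4 (4.2)]
-/

noncomputable section

open scoped MatrixGroups ModularForm

open CongruenceSubgroup Finset

open Literature.NumberTheory.EllipticCurves Literature.NumberTheory.EllipticCurves.ModularForms

namespace Summit.BirchSwinnertonDyer.Rank1Residual.LevelLowering

variable {R : Type*} [CommRing R]

/-! ### §1 The shifted Hecke derivative `E_q = H_q − a_q` -/

/-- The **shifted Hecke derivative** at `q` with shift function `a`: `E_q μ = H_q μ − a(q)·μ`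
(for the newform of `E` and `a q = a_q(E)`: `E_q = T_q − a_q`, which kills the symbol of `f`).
[cite: MazurTateTeitelbaum1986Invent, §I.4 (4.2)] -/
def heckeShift (a : ℕ → R) (q : ℕ) (μ : ℚ → R) : ℚ → R :=
  fun r ↦ heckeTransform q μ r - a q * μ r

variable (a : ℕ → R)

/-- Unfolding. [folklore] -/
theorem heckeShift_apply (q : ℕ) (μ : ℚ → R) (r : ℚ) :
    heckeShift a q μ r = heckeTransform q μ r - a q * μ r := rfl

/-- `H_q μ = a_q·μ + E_q μ`. [folklore] -/
theorem heckeTransform_eq_shift_add (q : ℕ) (μ : ℚ → R) (r : ℚ) :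
    heckeTransform q μ r = a q * μ r + heckeShift a q μ r := by
  simp only [heckeShift]
  ring

/-- `E_q μ` is periodic when `μ` is (`q > 0`). [folklore] -/
theorem IsPeriodic.heckeShift {μ : ℚ → R} (hμ : IsPeriodic μ) {q : ℕ} (hq : 0 < q) :
    IsPeriodic (heckeShift a q μ) :=
  (hμ.heckeTransform' hq).sub (fun r z ↦ by simp only [hμ r z])

/-- `E_q` is additive. [folklore] -/
theorem heckeShift_add (q : ℕ) (μ ν : ℚ → R) :
    heckeShift a q (fun x ↦ μ x + ν x) = fun x ↦ heckeShift a q μ x + heckeShift a q ν x := by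
  funext r
  simp only [heckeShift, heckeTransform_add]
  ring

/-- `E_q` commutes with scalars. [folklore] -/
theorem heckeShift_const_mul (q : ℕ) (c : R) (μ : ℚ → R) :
    heckeShift a q (fun x ↦ c * μ x) = fun x ↦ c * heckeShift a q μ x := by
  funext r
  simp only [heckeShift, heckeTransform_const_mul]
  ring

/-- `E_q (μ − ν) = E_q μ − E_q ν`. [folklore] -/
theorem heckeShift_sub (q : ℕ) (μ ν : ℚ → R) :
    heckeShift a q (fun x ↦ μ x - ν x) = fun x ↦ heckeShift a q μ x - heckeShift a q ν x := by
  funext r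
  simp only [heckeShift, heckeTransform_sub]
  ring

/-- `E_q 0 = 0`. [folklore] -/
theorem heckeShift_zero (q : ℕ) : heckeShift a q (fun _ : ℚ ↦ (0 : R)) = fun _ ↦ 0 := by
  funext r
  simp only [heckeShift, heckeTransform_zero, mul_zero, sub_zero]

/-- `E_q (−μ) = −E_q μ`. [folklore] -/
theorem heckeShift_neg (q : ℕ) (μ : ℚ → R) :
    heckeShift a q (fun x ↦ -μ x) = fun x ↦ -heckeShift a q μ x := by
  have h1 : (fun x ↦ -μ x) = fun x ↦ (-1 : R) * μ x := by funext x; ring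
  rw [h1, heckeShift_const_mul]
  funext x
  ring

/-- **`E_q` commutes with `[c]` for `c` prime to `q`** on periodic functions:
`E_q (μ∘[c]) = (E_q μ)∘[c]`. [cite: MazurTateTeitelbaum1986Invent, §I.4 (4.2)] -/
theorem heckeShift_comp_natMul {μ : ℚ → R} (hμ : IsPeriodic μ) {q c : ℕ} (hq : q.Prime)
    (hc : c.Coprime q) :
    heckeShift a q (fun x ↦ μ (c * x)) = fun r ↦ heckeShift a q μ (c * r) := by
  funext r
  simp only [heckeShift, heckeTransform_comp_natMul hμ hq hc r]

/-- `H_{q'} (E_q μ) = H_{q'} H_q μ − a_q H_{q'} μ`. [folklore] -/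
private theorem heckeTransform_heckeShift (q q' : ℕ) (μ : ℚ → R) (r : ℚ) :
    heckeTransform q' (heckeShift a q μ) r =
      heckeTransform q' (heckeTransform q μ) r - a q * heckeTransform q' μ r := by
  have hfun : heckeShift a q μ = fun x ↦ heckeTransform q μ x - (fun y ↦ a q * μ y) x := rfl
  rw [hfun, heckeTransform_sub, heckeTransform_const_mul]

/-- **The shifted derivatives COMMUTE on periodic functions** (distinct primes):
`E_q (E_{q'} μ) = E_{q'} (E_q μ)`. [cite: MazurTateTeitelbaum1986Invent, §I.4 (4.2)] -/
theorem heckeShift_comm {μ : ℚ → R} (hμ : IsPeriodic μ) {q q' : ℕ} (hq : q.Prime) (hq' : q'.Prime)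
    (hne : q ≠ q') : heckeShift a q (heckeShift a q' μ) = heckeShift a q' (heckeShift a q μ) := by
  funext r
  have h1 : heckeShift a q (heckeShift a q' μ) r =
      heckeTransform q (heckeShift a q' μ) r - a q * heckeShift a q' μ r := rfl
  have h2 : heckeShift a q' (heckeShift a q μ) r =
      heckeTransform q' (heckeShift a q μ) r - a q' * heckeShift a q μ r := rfl
  rw [h1, h2, heckeTransform_heckeShift, heckeTransform_heckeShift]
  simp only [heckeShift]
  rw [heckeTransform_comm hμ hq hq' hne r]
  ring

/-! ### §2 Iterated shifted derivatives along a list -/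

/-- Iterate `E_q` along a list: `E_{[q₁,…,q_k]} γ = E_{q₁}(E_{q₂}(⋯ γ))`. [folklore] -/
def shiftDerivList : List ℕ → (ℚ → R) → (ℚ → R)
  | [], γ => γ
  | q :: l, γ => heckeShift a q (shiftDerivList l γ)

/-- Unfolding on a cons. [folklore] -/
theorem shiftDerivList_cons (q : ℕ) (l : List ℕ) (γ : ℚ → R) :
    shiftDerivList a (q :: l) γ = heckeShift a q (shiftDerivList a l γ) := rfl

/-- Unfolding on an append of a singleton: the innermost derivative. [folklore] -/
theorem shiftDerivList_append_singleton (l : List ℕ) (q : ℕ) (γ : ℚ → R) :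
    shiftDerivList a (l ++ [q]) γ = shiftDerivList a l (heckeShift a q γ) := by
  induction l with
  | nil => rfl
  | cons x l ih => simp only [List.cons_append, shiftDerivList_cons, ih]

/-- Periodicity is preserved along a list of positive integers. [folklore] -/
theorem IsPeriodic.shiftDerivList {γ : ℚ → R} (hγ : IsPeriodic γ) :
    ∀ l : List ℕ, (∀ q ∈ l, 0 < q) → IsPeriodic (shiftDerivList a l γ)
  | [], _ => hγ
  | q :: l, hl => by
    rw [shiftDerivList_cons]
    exact (IsPeriodic.shiftDerivList hγ l fun x hx ↦ hl x (List.mem_cons_of_mem q hx)).heckeShift a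
      (hl q List.mem_cons_self)

/-- **Order independence**: for a periodic `γ` and duplicate-free lists of primes that are permutations
of each other, the iterated shifted derivatives agree (`heckeShift_comm`). [folklore] -/
theorem shiftDerivList_perm {γ : ℚ → R} (hγ : IsPeriodic γ) {l l' : List ℕ} (h : l.Perm l')
    (hp : ∀ q ∈ l, q.Prime) (hnd : l.Nodup) : shiftDerivList a l γ = shiftDerivList a l' γ := by
  induction h with
  | nil => rfl
  | cons x _ ih =>
    simp only [shiftDerivList_cons]
    rw [ih (fun q hq ↦ hp q (List.mem_cons_of_mem x hq)) (List.Nodup.of_cons hnd)]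
  | swap x y l =>
    simp only [shiftDerivList_cons]
    have hx : x.Prime := hp x (List.mem_cons_of_mem y List.mem_cons_self)
    have hy : y.Prime := hp y List.mem_cons_self
    have hne : y ≠ x := by
      intro hxy
      have := (List.nodup_cons.mp hnd).1
      exact this (hxy ▸ List.mem_cons_self)
    have hper : IsPeriodic (shiftDerivList a l γ) :=
      hγ.shiftDerivList a l fun q hq ↦
        (hp q (List.mem_cons_of_mem y (List.mem_cons_of_mem x hq))).pos
    exact heckeShift_comm a hper hy hx hne
  | trans h₁ _ ih₁ ih₂ =>
    rw [ih₁ hp hnd, ih₂ (fun q hq ↦ hp q (h₁.mem_iff.mpr hq)) (h₁.nodup_iff.mp hnd)]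

/-- Linearity along a list: sums. [folklore] -/
theorem shiftDerivList_add (μ ν : ℚ → R) :
    ∀ l : List ℕ, shiftDerivList a l (fun x ↦ μ x + ν x) =
      fun x ↦ shiftDerivList a l μ x + shiftDerivList a l ν x
  | [] => rfl
  | q :: l => by
    simp only [shiftDerivList_cons]
    rw [shiftDerivList_add μ ν l, heckeShift_add]

/-- Linearity along a list: scalars. [folklore] -/
theorem shiftDerivList_const_mul (c : R) (μ : ℚ → R) :
    ∀ l : List ℕ, shiftDerivList a l (fun x ↦ c * μ x) = fun x ↦ c * shiftDerivList a l μ x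
  | [] => rfl
  | q :: l => by
    simp only [shiftDerivList_cons]
    rw [shiftDerivList_const_mul c μ l, heckeShift_const_mul]

/-- `E_l (γ∘[c]) = (E_l γ)∘[c]` for `c` prime to every (prime) entry of `l`, `γ` periodic. [folklore] -/
theorem shiftDerivList_comp_natMul {γ : ℚ → R} (hγ : IsPeriodic γ) {c : ℕ} :
    ∀ l : List ℕ, (∀ q ∈ l, q.Prime) → (∀ q ∈ l, c.Coprime q) →
      shiftDerivList a l (fun x ↦ γ (c * x)) = fun r ↦ shiftDerivList a l γ (c * r)
  | [], _, _ => rfl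
  | q :: l, hp, hc => by
    simp only [shiftDerivList_cons]
    rw [shiftDerivList_comp_natMul hγ l (fun x hx ↦ hp x (List.mem_cons_of_mem q hx))
      (fun x hx ↦ hc x (List.mem_cons_of_mem q hx))]
    exact heckeShift_comp_natMul a
      (hγ.shiftDerivList a l fun x hx ↦ (hp x (List.mem_cons_of_mem q hx)).pos)
      (hp q List.mem_cons_self) (hc q List.mem_cons_self)

/-! ### §3 The family on finite sets -/

/-- **The shifted derivative family generated by `γ`**: `D^a_U γ := (∏_{q ∈ U} (H_q − a_q)) γ`,
realised along the sorted list of `U` (order-independent by `shiftDerivList_perm`).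
[cite: MazurTateTeitelbaum1986Invent, §I.4 (4.2)] -/
def shiftDeriv (γ : ℚ → R) (U : Finset ℕ) : ℚ → R :=
  shiftDerivList a (U.sort (· ≤ ·)) γ

/-- `D_∅ γ = γ`. [folklore] -/
theorem shiftDeriv_empty (γ : ℚ → R) : shiftDeriv a γ ∅ = γ := by
  simp [shiftDeriv, shiftDerivList]

/-- Periodicity of `D_U γ` (`U` a set of primes). [folklore] -/
theorem IsPeriodic.shiftDeriv {γ : ℚ → R} (hγ : IsPeriodic γ) {U : Finset ℕ}
    (hU : ∀ q ∈ U, q.Prime) : IsPeriodic (shiftDeriv a γ U) :=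
  hγ.shiftDerivList a _ fun q hq ↦ (hU q ((Finset.mem_sort _).mp hq)).pos

/-- **`D_{U ∪ {q}} γ = E_q (D_U γ)`** for a prime `q ∉ U`, `U` a set of primes, `γ` periodic. [folklore] -/
theorem shiftDeriv_insert {γ : ℚ → R} (hγ : IsPeriodic γ) {U : Finset ℕ} (hU : ∀ q ∈ U, q.Prime)
    {q : ℕ} (hq : q.Prime) (hqU : q ∉ U) :
    shiftDeriv a γ (insert q U) = heckeShift a q (shiftDeriv a γ U) := by
  unfold shiftDeriv
  rw [← shiftDerivList_cons]
  have hperm : ((insert q U).sort (· ≤ ·)).Perm (q :: U.sort (· ≤ ·)) := by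
    apply List.perm_of_nodup_nodup_toFinset_eq (Finset.sort_nodup _ _)
    · exact List.nodup_cons.mpr ⟨by simpa using hqU, Finset.sort_nodup _ _⟩
    · ext x
      simp
  refine shiftDerivList_perm a hγ hperm ?_ (Finset.sort_nodup _ _)
  intro x hx
  rcases Finset.mem_insert.mp ((Finset.mem_sort _).mp hx) with rfl | hx'
  exacts [hq, hU x hx']

/-- **THE SHIFTED DERIVATIVE-FAMILY RELATION** `H_q (D_U γ) = a_q·D_U γ + D_{U ∪ {q}} γ` for a
prime `q ∉ U`, `U` a set of primes and `γ` periodic — the shape of clause (i) of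
`PlusSymbolLevelLowersAdditivelyModAt` (`X4/KuriharaAdditiveCertificate.lean`). [folklore] -/
theorem heckeTransform_shiftDeriv {γ : ℚ → R} (hγ : IsPeriodic γ) {U : Finset ℕ}
    (hU : ∀ q ∈ U, q.Prime) {q : ℕ} (hq : q.Prime) (hqU : q ∉ U) (r : ℚ) :
    heckeTransform q (shiftDeriv a γ U) r =
      a q * shiftDeriv a γ U r + shiftDeriv a γ (insert q U) r := by
  rw [shiftDeriv_insert a hγ hU hq hqU, heckeTransform_eq_shift_add a]

/-- **The inner shift commutes out**: `D_U (E_q γ) = D_{U ∪ {q}} γ` for a prime `q ∉ U`, `U` a set of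
primes, `γ` periodic. [folklore] -/
theorem shiftDeriv_heckeShift {γ : ℚ → R} (hγ : IsPeriodic γ) {U : Finset ℕ}
    (hU : ∀ q ∈ U, q.Prime) {q : ℕ} (hq : q.Prime) (hqU : q ∉ U) :
    shiftDeriv a (heckeShift a q γ) U = shiftDeriv a γ (insert q U) := by
  unfold shiftDeriv
  rw [← shiftDerivList_append_singleton]
  have hperm : ((insert q U).sort (· ≤ ·)).Perm (U.sort (· ≤ ·) ++ [q]) := by
    apply List.perm_of_nodup_nodup_toFinset_eq (Finset.sort_nodup _ _)
    · refine List.Nodup.append (Finset.sort_nodup _ _) (List.nodup_singleton q) ?_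
      intro x hx hx'
      rw [List.mem_singleton] at hx'
      subst hx'
      exact hqU ((Finset.mem_sort _).mp hx)
    · ext x
      simp
  refine (shiftDerivList_perm a hγ hperm ?_ (Finset.sort_nodup _ _)).symm
  intro x hx
  rcases Finset.mem_insert.mp ((Finset.mem_sort _).mp hx) with rfl | hx'
  exacts [hq, hU x hx']

/-! ### §4 Linearity in `γ` and commutation with `[c]` -/

/-- `D_U (μ + ν) = D_U μ + D_U ν`. [folklore] -/
theorem shiftDeriv_add (μ ν : ℚ → R) (U : Finset ℕ) :
    shiftDeriv a (fun x ↦ μ x + ν x) U = fun x ↦ shiftDeriv a μ U x + shiftDeriv a ν U x :=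
  shiftDerivList_add a μ ν _

/-- `D_U (c·μ) = c·D_U μ`. [folklore] -/
theorem shiftDeriv_const_mul (c : R) (μ : ℚ → R) (U : Finset ℕ) :
    shiftDeriv a (fun x ↦ c * μ x) U = fun x ↦ c * shiftDeriv a μ U x :=
  shiftDerivList_const_mul a c μ _

/-- `D_U (μ − ν) = D_U μ − D_U ν`. [folklore] -/
theorem shiftDeriv_sub (μ ν : ℚ → R) (U : Finset ℕ) :
    shiftDeriv a (fun x ↦ μ x - ν x) U = fun x ↦ shiftDeriv a μ U x - shiftDeriv a ν U x := by
  have h1 : (fun x ↦ μ x - ν x) = fun x ↦ μ x + (fun y ↦ (-1 : R) * ν y) x := by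
    funext x; simp; ring
  rw [h1, shiftDeriv_add, shiftDeriv_const_mul]
  funext x
  ring

/-- `D_U (−μ) = −D_U μ`. [folklore] -/
theorem shiftDeriv_neg (μ : ℚ → R) (U : Finset ℕ) :
    shiftDeriv a (fun x ↦ -μ x) U = fun x ↦ -shiftDeriv a μ U x := by
  have h1 : (fun x ↦ -μ x) = fun x ↦ (-1 : R) * μ x := by funext x; ring
  rw [h1, shiftDeriv_const_mul]
  funext x
  ring

/-- `D_U 0 = 0`. [folklore] -/
theorem shiftDeriv_zero (U : Finset ℕ) : shiftDeriv a (fun _ : ℚ ↦ (0 : R)) U = fun _ ↦ 0 := by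
  have : (fun _ : ℚ ↦ (0 : R)) = fun x ↦ (0 : R) * (0 : R) := by funext; simp
  rw [this, shiftDeriv_const_mul]
  funext
  simp

/-- **`D_U (γ∘[c]) = (D_U γ)∘[c]`** for `c` prime to every prime of `U`, `γ` periodic. [folklore] -/
theorem shiftDeriv_comp_natMul {γ : ℚ → R} (hγ : IsPeriodic γ) {U : Finset ℕ}
    (hU : ∀ q ∈ U, q.Prime) {c : ℕ} (hc : ∀ q ∈ U, c.Coprime q) :
    shiftDeriv a (fun x ↦ γ (c * x)) U = fun r ↦ shiftDeriv a γ U (c * r) :=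
  shiftDerivList_comp_natMul a hγ _ (fun q hq ↦ hU q ((Finset.mem_sort _).mp hq))
    (fun q hq ↦ hc q ((Finset.mem_sort _).mp hq))

/-- `D_U (μ − μ∘[c]) = D_U μ − (D_U μ)∘[c]` (`c` prime to `U`, `μ` periodic) — the shape of the
`τ`-identities. [folklore] -/
theorem shiftDeriv_sub_comp_natMul {μ : ℚ → R} (hμ : IsPeriodic μ) {U : Finset ℕ}
    (hU : ∀ q ∈ U, q.Prime) {c : ℕ} (hc : ∀ q ∈ U, c.Coprime q) :
    shiftDeriv a (fun x ↦ μ x - μ (c * x)) U =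
      fun r ↦ shiftDeriv a μ U r - shiftDeriv a μ U (c * r) := by
  have h1 : (fun x ↦ μ x - μ (c * x)) = fun x ↦ μ x - (fun y ↦ μ (c * y)) x := rfl
  rw [h1, shiftDeriv_sub, shiftDeriv_comp_natMul a hμ hU hc]

end Summit.BirchSwinnertonDyer.Rank1Residual.LevelLowering

end
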